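import Mathlib
import HarnessLib

/-!
# Route `KLProgramme`, crux K3 `KLRegimeTwoPointLimit` — the particle–particle / particle–hole SPLIT of a four-legged kernel
# (Lemma E.5 (iv) of HOME/p1/E5-NOTE.md; DECOMP App. E, E1 «the channel FORMS of C2 are read off the sector array»; cell gate-hubbard-kl, seat p1)

Feldman–Knörrer–Trubowitz (*A two dimensional Fermi liquid. Part 2: Convergence*, CMP 247 (2004) 49–111, §VII, Lemma on the decomposition of
ladders, «whose proof is trivial») observe that an antisymmetric, particle-number-conserving four-legged kernel `f` over a leg space
`X × {0,1}` (undirected datum `x : X` = position/spin/sector, and a creation–annihilation index) is COMPLETELY determined by two kernels over `X`: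
its particle–particle reduction `f^{pp}(x₁,x₂,x₃,x₄) = f((x₁,0),(x₂,0),(x₃,1),(x₄,1))` and its particle–hole reduction
`f^{ph}(x₁,x₂,x₃,x₄) = f((x₁,0),(x₂,1),(x₃,1),(x₄,0))`, through the explicit formula `f = V_pp(f^{pp}) + V_ph(f^{ph})` with
`V_pp(g)(z) = δ_{0011} g(u₁,u₂,u₃,u₄) + δ_{1100} g(u₃,u₄,u₁,u₂)` and
`V_ph(g)(z) = δ_{0110} g(u₁,u₂,u₃,u₄) + δ_{1001} g(u₂,u₁,u₄,u₃) − δ_{1010} g(u₂,u₁,u₃,u₄) − δ_{0101} g(u₁,u₂,u₄,u₃)`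
(`u_i` the undirected parts, `δ_{b₁b₂b₃b₄}` the indicator of the creation pattern).  This is the kernel-level form of «the channel is read off the
array»: the Cooper-channel array `V_j(q)` of C1/C2 is the `pp` reduction of the (Wick-ordered) running coupling, the Kohn–Luttinger source lives in
the `ph` reduction, and nothing else exists.  We prove the formula with the six indicator terms written out (no auxiliary definitions), for
kernels with values in any additive commutative group, from antisymmetry under the three adjacent transpositions and vanishing off the
two-creation patterns; plus the even-permutation identities it rests on.  Creation index: `Bool` (`true` = creation).
-/

namespace Summit.HubbardSuperconductivity.HubbardSuperconductivity.Theorems.LadderChannelSplit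

set_option linter.dupNamespace false -- summit = problem name (single-conjunct summit), D-0017

variable {Y : Type*} {A : Type*} [AddCommGroup A]

/-- From antisymmetry under the adjacent transpositions: the double transposition `(12)(34)` is even, `f b a d c = f a b c d`. -/
theorem perm_2143 (f : Y → Y → Y → Y → A)
    (h12 : ∀ a b c d, f b a c d = -f a b c d) (h34 : ∀ a b c d, f a b d c = -f a b c d) (a b c d : Y) :
    f b a d c = f a b c d := by
  rw [h34, h12, neg_neg]

/-- From antisymmetry under the adjacent transpositions: the pair exchange `(13)(24)` is even, `f c d a b = f a b c d`. -/
theorem perm_3412 (f : Y → Y → Y → Y → A)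
    (h12 : ∀ a b c d, f b a c d = -f a b c d) (h23 : ∀ a b c d, f a c b d = -f a b c d)
    (h34 : ∀ a b c d, f a b d c = -f a b c d) (a b c d : Y) :
    f c d a b = f a b c d := by
  -- c d a b → c a d b → a c d b → a c b d → a b c d
  have e1 : f c d a b = -f c a d b := by rw [← h23]
  have e2 : f c a d b = -f a c d b := h12 a c d b
  have e3 : f a c d b = -f a c b d := h34 a c b d
  have e4 : f a c b d = -f a b c d := h23 a b c d
  rw [e1, e2, e3, e4]; simp

/-- From antisymmetry: the transposition `(13)` is odd, `f c b a d = -f a b c d`. -/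
theorem perm_3214 (f : Y → Y → Y → Y → A)
    (h12 : ∀ a b c d, f b a c d = -f a b c d) (h23 : ∀ a b c d, f a c b d = -f a b c d) (a b c d : Y) :
    f c b a d = -f a b c d := by
  -- c b a d → b c a d → b a c d → a b c d
  rw [h12 b c a d, h23 b a c d, h12 a b c d]; simp

variable {X : Type*}

/-- Number of creation legs among four creation indices. -/
theorem creationCount_eq (b₁ b₂ b₃ b₄ : Bool) :
    b₁.toNat + b₂.toNat + b₃.toNat + b₄.toNat
      = (if b₁ then 1 else 0) + (if b₂ then 1 else 0) + (if b₃ then 1 else 0) + (if b₄ then 1 else 0) := by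
  cases b₁ <;> cases b₂ <;> cases b₃ <;> cases b₄ <;> rfl

/-- **The pp/ph split** (FKT 2004, Part 2 §VII Lemma (ii)).  Let `f` be a four-legged kernel over `X × Bool` with values in an additive
commutative group, antisymmetric under the three adjacent transpositions and vanishing unless exactly two legs are creation legs.  Then `f`
equals the sum of the particle–particle value of its pp reduction and the particle–hole value of its ph reduction — written out, for all legs
`zᵢ = (xᵢ, bᵢ)`:
`f z₁ z₂ z₃ z₄ = [b = 0011] f^{pp}(x₁,x₂,x₃,x₄) + [b = 1100] f^{pp}(x₃,x₄,x₁,x₂) + [b = 0110] f^{ph}(x₁,x₂,x₃,x₄) + [b = 1001] f^{ph}(x₂,x₁,x₄,x₃)`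
`− [b = 1010] f^{ph}(x₂,x₁,x₃,x₄) − [b = 0101] f^{ph}(x₁,x₂,x₄,x₃)`. -/
theorem eq_ppValue_add_phValue (f : (X × Bool) → (X × Bool) → (X × Bool) → (X × Bool) → A)
    (h12 : ∀ a b c d, f b a c d = -f a b c d) (h23 : ∀ a b c d, f a c b d = -f a b c d)
    (h34 : ∀ a b c d, f a b d c = -f a b c d)
    (hN : ∀ z₁ z₂ z₃ z₄ : X × Bool, z₁.2.toNat + z₂.2.toNat + z₃.2.toNat + z₄.2.toNat ≠ 2 → f z₁ z₂ z₃ z₄ = 0)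
    (x₁ x₂ x₃ x₄ : X) (b₁ b₂ b₃ b₄ : Bool) :
    f (x₁, b₁) (x₂, b₂) (x₃, b₃) (x₄, b₄)
      = (if (b₁ = false ∧ b₂ = false ∧ b₃ = true ∧ b₄ = true) then f (x₁, false) (x₂, false) (x₃, true) (x₄, true) else 0)
      + (if (b₁ = true ∧ b₂ = true ∧ b₃ = false ∧ b₄ = false) then f (x₃, false) (x₄, false) (x₁, true) (x₂, true) else 0)
      + (if (b₁ = false ∧ b₂ = true ∧ b₃ = true ∧ b₄ = false) then f (x₁, false) (x₂, true) (x₃, true) (x₄, false) else 0)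
      + (if (b₁ = true ∧ b₂ = false ∧ b₃ = false ∧ b₄ = true) then f (x₂, false) (x₁, true) (x₄, true) (x₃, false) else 0)
      - (if (b₁ = true ∧ b₂ = false ∧ b₃ = true ∧ b₄ = false) then f (x₂, false) (x₁, true) (x₃, true) (x₄, false) else 0)
      - (if (b₁ = false ∧ b₂ = true ∧ b₃ = false ∧ b₄ = true) then f (x₁, false) (x₂, true) (x₄, true) (x₃, false) else 0) := by
  cases b₁ <;> cases b₂ <;> cases b₃ <;> cases b₄ <;>
    simp only [and_true, and_self, if_true, if_false, Bool.true_eq_false, Bool.false_eq_true, and_false,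
      add_zero, zero_add, sub_zero, zero_sub]
  -- the ten non-conserving patterns
  case false.false.false.false => exact hN _ _ _ _ (by simp)
  case false.false.false.true => exact hN _ _ _ _ (by simp)
  case false.false.true.false => exact hN _ _ _ _ (by simp)
  case false.true.false.false => exact hN _ _ _ _ (by simp)
  case true.false.false.false => exact hN _ _ _ _ (by simp)
  case false.true.true.true => exact hN _ _ _ _ (by simp)
  case true.false.true.true => exact hN _ _ _ _ (by simp)
  case true.true.false.true => exact hN _ _ _ _ (by simp)
  case true.true.true.false => exact hN _ _ _ _ (by simp)
  case true.true.true.true => exact hN _ _ _ _ (by simp)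
  -- 0011 and 0110 are literal (closed by `simp only`); the remaining four are even/odd permutations
  case false.true.false.true => -- 0101 : f z₁ z₂ z₃ z₄ = - f z₁ z₂ z₄ z₃
    exact (neg_eq_iff_eq_neg.mp (h34 _ _ _ _).symm)
  case true.false.false.true => -- 1001 : f z₁ z₂ z₃ z₄ = f z₂ z₁ z₄ z₃
    exact (perm_2143 f h12 h34 _ _ _ _).symm
  case true.false.true.false => -- 1010 : f z₁ z₂ z₃ z₄ = - f z₂ z₁ z₃ z₄
    exact (neg_eq_iff_eq_neg.mp (h12 _ _ _ _).symm)
  case true.true.false.false => -- 1100 : f z₁ z₂ z₃ z₄ = f z₃ z₄ z₁ z₂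
    exact (perm_3412 f h12 h23 h34 _ _ _ _).symm

/-- **Uniqueness of the split / the channels are complementary.**  On the six two-creation patterns the formula reads `f` at ONE pattern
through ONE reduction: in particular the pp reduction of `f` determines `f` on the patterns `0011, 1100` and the ph reduction on
`0110, 1001, 1010, 0101`; a kernel whose pp reduction vanishes is supported on the ph patterns and vice versa. -/
theorem eq_zero_of_reductions_eq_zero (f : (X × Bool) → (X × Bool) → (X × Bool) → (X × Bool) → A)
    (h12 : ∀ a b c d, f b a c d = -f a b c d) (h23 : ∀ a b c d, f a c b d = -f a b c d)
    (h34 : ∀ a b c d, f a b d c = -f a b c d)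
    (hN : ∀ z₁ z₂ z₃ z₄ : X × Bool, z₁.2.toNat + z₂.2.toNat + z₃.2.toNat + z₄.2.toNat ≠ 2 → f z₁ z₂ z₃ z₄ = 0)
    (hpp : ∀ x₁ x₂ x₃ x₄ : X, f (x₁, false) (x₂, false) (x₃, true) (x₄, true) = 0)
    (hph : ∀ x₁ x₂ x₃ x₄ : X, f (x₁, false) (x₂, true) (x₃, true) (x₄, false) = 0) :
    ∀ z₁ z₂ z₃ z₄, f z₁ z₂ z₃ z₄ = 0 := by
  rintro ⟨x₁, b₁⟩ ⟨x₂, b₂⟩ ⟨x₃, b₃⟩ ⟨x₄, b₄⟩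
  rw [eq_ppValue_add_phValue f h12 h23 h34 hN]
  simp [hpp, hph]

/-- The particle–particle patterns: if the ph reduction of `f` vanishes then `f` is supported on `{0011, 1100}` and is there given by
its pp reduction — `f z = [b=0011] f^{pp}(x₁,x₂,x₃,x₄) + [b=1100] f^{pp}(x₃,x₄,x₁,x₂)` (the form `V_pp(f^{pp})` of FKT). -/
theorem eq_ppValue_of_phReduction_eq_zero (f : (X × Bool) → (X × Bool) → (X × Bool) → (X × Bool) → A)
    (h12 : ∀ a b c d, f b a c d = -f a b c d) (h23 : ∀ a b c d, f a c b d = -f a b c d)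
    (h34 : ∀ a b c d, f a b d c = -f a b c d)
    (hN : ∀ z₁ z₂ z₃ z₄ : X × Bool, z₁.2.toNat + z₂.2.toNat + z₃.2.toNat + z₄.2.toNat ≠ 2 → f z₁ z₂ z₃ z₄ = 0)
    (hph : ∀ x₁ x₂ x₃ x₄ : X, f (x₁, false) (x₂, true) (x₃, true) (x₄, false) = 0)
    (x₁ x₂ x₃ x₄ : X) (b₁ b₂ b₃ b₄ : Bool) :
    f (x₁, b₁) (x₂, b₂) (x₃, b₃) (x₄, b₄)
      = (if (b₁ = false ∧ b₂ = false ∧ b₃ = true ∧ b₄ = true) then f (x₁, false) (x₂, false) (x₃, true) (x₄, true) else 0)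
      + (if (b₁ = true ∧ b₂ = true ∧ b₃ = false ∧ b₄ = false) then f (x₃, false) (x₄, false) (x₁, true) (x₂, true) else 0) := by
  rw [eq_ppValue_add_phValue f h12 h23 h34 hN]
  simp [hph]

/-- The particle–hole patterns: if the pp reduction of `f` vanishes then `f` is supported on `{0110, 1001, 1010, 0101}` and is there given
by its ph reduction with the signs of `V_ph`. -/
theorem eq_phValue_of_ppReduction_eq_zero (f : (X × Bool) → (X × Bool) → (X × Bool) → (X × Bool) → A)
    (h12 : ∀ a b c d, f b a c d = -f a b c d) (h23 : ∀ a b c d, f a c b d = -f a b c d)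
    (h34 : ∀ a b c d, f a b d c = -f a b c d)
    (hN : ∀ z₁ z₂ z₃ z₄ : X × Bool, z₁.2.toNat + z₂.2.toNat + z₃.2.toNat + z₄.2.toNat ≠ 2 → f z₁ z₂ z₃ z₄ = 0)
    (hpp : ∀ x₁ x₂ x₃ x₄ : X, f (x₁, false) (x₂, false) (x₃, true) (x₄, true) = 0)
    (x₁ x₂ x₃ x₄ : X) (b₁ b₂ b₃ b₄ : Bool) :
    f (x₁, b₁) (x₂, b₂) (x₃, b₃) (x₄, b₄)
      = (if (b₁ = false ∧ b₂ = true ∧ b₃ = true ∧ b₄ = false) then f (x₁, false) (x₂, true) (x₃, true) (x₄, false) else 0)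
      + (if (b₁ = true ∧ b₂ = false ∧ b₃ = false ∧ b₄ = true) then f (x₂, false) (x₁, true) (x₄, true) (x₃, false) else 0)
      - (if (b₁ = true ∧ b₂ = false ∧ b₃ = true ∧ b₄ = false) then f (x₂, false) (x₁, true) (x₃, true) (x₄, false) else 0)
      - (if (b₁ = false ∧ b₂ = true ∧ b₃ = false ∧ b₄ = true) then f (x₁, false) (x₂, true) (x₄, true) (x₃, false) else 0) := by
  rw [eq_ppValue_add_phValue f h12 h23 h34 hN]
  simp [hpp]

/-- The two reductions inherit the exchange symmetries that make the Cooper array Hermitian-like and the ph kernel crossing-symmetric: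
`f^{pp}(x₂,x₁,x₃,x₄) = -f^{pp}(x₁,x₂,x₃,x₄)`, `f^{pp}(x₁,x₂,x₄,x₃) = -f^{pp}(x₁,x₂,x₃,x₄)` (antisymmetry inside the incoming and inside the
outgoing pair), and `f^{ph}(x₄,x₃,x₂,x₁) = f^{ph}(x₁,x₂,x₃,x₄)` (the reversal `(14)(23)` is even). -/
theorem reduction_symmetries (f : (X × Bool) → (X × Bool) → (X × Bool) → (X × Bool) → A)
    (h12 : ∀ a b c d, f b a c d = -f a b c d) (h23 : ∀ a b c d, f a c b d = -f a b c d)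
    (h34 : ∀ a b c d, f a b d c = -f a b c d) (x₁ x₂ x₃ x₄ : X) :
    f (x₂, false) (x₁, false) (x₃, true) (x₄, true) = -f (x₁, false) (x₂, false) (x₃, true) (x₄, true)
    ∧ f (x₁, false) (x₂, false) (x₄, true) (x₃, true) = -f (x₁, false) (x₂, false) (x₃, true) (x₄, true)
    ∧ f (x₄, false) (x₃, true) (x₂, true) (x₁, false) = f (x₁, false) (x₂, true) (x₃, true) (x₄, false) := by
  refine ⟨h12 _ _ _ _, h34 _ _ _ _, ?_⟩
  -- (14)(23): d c b a → c d b a?  use: d c b a = -(c d b a) [h12] ; c d b a = -(c b d a) [h23]... go via perm_3412 then perm_2143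
  -- d c b a = (perm_3412) b a d c = (perm_2143) a b c d
  have e1 := perm_3412 f h12 h23 h34 (x₂, true) (x₁, false) (x₄, false) (x₃, true)
  -- e1 : f (x₄,false) (x₃,true) (x₂,true) (x₁,false) = f (x₂,true) (x₁,false) (x₄,false) (x₃,true)
  have e2 := perm_2143 f h12 h34 (x₁, false) (x₂, true) (x₃, true) (x₄, false)
  -- e2 : f (x₂,true) (x₁,false) (x₄,false) (x₃,true) = f (x₁,false) (x₂,true) (x₃,true) (x₄,false)
  rw [e1, e2]

end Summit.HubbardSuperconductivity.HubbardSuperconductivity.Theorems.LadderChannelSplit
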